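import Literature.AlgebraicGeometry.Motives.HodgeLieWeightOneLeviInvolutionAlgebra
import HarnessLib

/-!
# Weight one: COMPRESSION of lowering operators by Levi idempotents — `Z₂Z₁ x Z₁Z₂ ∈ 𝔥⁻`, its vanishing on a line,
# and the commutator criterion `[Z, x] = 0 ⟸ γ_x(A·, ·) + γ_x(·, A·) = 0`
# (brick S1 «weight-2 compression» of the Segre-compression return leg of the rank-twelve crux; Deligne I §3,
# Moonen–Zarhin 1999 (2.3)–(2.5); classification-free)

Family `hodge`, layer `Literature/AlgebraicGeometry/Motives`; THEOREMS ONLY (no definition, no named fact; D-0026).  Written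
for the cell `pub-hodgeav-hg6` (LADDER-HodgeAV row 2, TABLE X row 1 `g6.I(1)`: the `r = 4` return leg of
`RankTwelveSimpleCrux34`, eng-2 lineage g5, brick C; honest framing: HC / HC_AV / HC_CM NOT proved — unconditional Hodge–Lie
linear algebra).

SETTING.  `H` effective polarized of weight `1`, `P = V^{1,0}`, `Q = V^{0,1}`, `𝔥_ℂ = Lie Hg ⊗ ℂ`, `ω = ψ_ℂ` (alternating,
non-degenerate, `P`, `Q` isotropic).  A LOWERING operator `x ∈ 𝔥_ℂ` (`x Q = 0`, `x V_ℂ ⊆ Q`) is the same thing as the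
SYMMETRIC bilinear form `γ_x(p, p′) = ω(x p, p′)` on `P`; a LEVI element `Z ∈ 𝔥_ℂ` (`Z P ⊆ P`, `Z Q ⊆ Q`) acts on it by
`γ_{[Z,x]}(p, p′) = −(γ_x(Z p, p′) + γ_x(p, Z p′))` (`Z|_Q = −(Z|_P)^†` by `ω`-skewness).

WHAT IS PROVED.
* §1 (abstract, any `𝔊 ⊆ End(M)` bracket-closed, complementary `P′, Q′`) **`LeviCompression.mul_mul_mul_mem`** — if
  `Z ∈ 𝔊` is idempotent on `P′` and anti-idempotent on `Q′` and `x ∈ 𝔊` kills `P′` with values in `P′`, then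
  `Z x Z = ½([Z,x] − [Z,[Z,x]]) ∈ 𝔊` (the weight-`2` compression: `ad Z` has eigenvalues `2, 1, 0` on `Hom(Q′, P′)`).
* §2 (weight one) **`LeviCompression.exists_levi_lift`** — an element of `𝔥_ℂ` preserving `P` has a LEVI modification with the
  same restriction to `P` (`SymplecticTheta.exists_decomp`); **`LeviCompression.sq_apply_eq_neg_of_sq_apply_eq`** — a Levi
  element idempotent on `P` is anti-idempotent on `Q` (`ω`-duality).
* §3 **`LeviCompression.compression_mem`** — for Levi `Z₁, Z₂ ∈ 𝔥_ℂ` idempotent on `P` and `x ∈ 𝔥_ℂ` lowering,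
  `Z₂Z₁ x Z₁Z₂ ∈ 𝔥_ℂ` is lowering; **`LeviCompression.form_compression_eq_zero`** — if moreover no non-zero lowering element of
  `𝔥_ℂ` has its values on a line and `(Z₁Z₂)(P)` lies on a line, then `γ_x(Z₁Z₂ p, Z₁Z₂ p′) = 0` for all `p, p′ ∈ P`.
* §4 **`LeviCompression.commute_of_form`** — for Levi `Z` and lowering `x`: if `γ_x(Z p, p′) + γ_x(p, Z p′) = 0` on `P`, then
  `Z x = x Z`.
SEQUEL (same cell): the Segre brick (`SkeletonSegre.form_offDiag_eq_zero`) turns §3 into the hypothesis of §4 for the block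
unit `P₁₂` of the tensor skeleton of a `2|4` Levi involution algebra; the trace-form brick then contradicts simplicity.

## References

* [Deligne1982HodgeCycles] P. Deligne, *Hodge cycles on abelian varieties*, LNM 900 (1982), I §3 (Prop. 3.4, 3.6).
* [MoonenZarhin1999LowDim] B. Moonen, Yu. Zarhin, *Hodge classes on abelian varieties of low dimension*, Math. Ann. 315 (1999),
  §2 (2.3)–(2.5).
-/

noncomputable section

open scoped TensorProduct

namespace Literature.AlgebraicGeometry.Motives

namespace HodgeStructure

universe u

/-! ## §1 The abstract weight-two compression -/

/-- **Weight-`2` compression.**  `𝔊 ⊆ End(M)` bracket-closed; `M = P′ + Q′`; `Z ∈ 𝔊` with `Z² = Z` on `P′`, `Z P′ ⊆ P′`,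
`Z² = −Z` on `Q′`; `x ∈ 𝔊` killing `P′` with values in `P′`.  Then `Z x Z ∈ 𝔊` — indeed
`2·ZxZ = [Z,x] − [Z,[Z,x]]`. [cite: Deligne1982HodgeCycles, I §3 (proof of Prop. 3.4)] [cite: MoonenZarhin1999LowDim, §2 (2.3)] -/
theorem LeviCompression.mul_mul_mul_mem {M : Type*} [AddCommGroup M] [Module ℂ M] {𝔊 : Submodule ℂ (Module.End ℂ M)}
    (hbr : ∀ Y ∈ 𝔊, ∀ Z ∈ 𝔊, Y * Z - Z * Y ∈ 𝔊) {P' Q' : Submodule ℂ M} (hdec : ∀ v, ∃ p ∈ P', ∃ q ∈ Q', v = p + q)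
    {Z : Module.End ℂ M} (hZ : Z ∈ 𝔊) (hZP : ∀ p ∈ P', Z (Z p) = Z p) (hZP' : ∀ p ∈ P', Z p ∈ P')
    (hZQ : ∀ q ∈ Q', Z (Z q) = -Z q) {x : Module.End ℂ M} (hx : x ∈ 𝔊) (hxP : ∀ p ∈ P', x p = 0)
    (hxim : ∀ v, x v ∈ P') : Z * x * Z ∈ 𝔊 := by
  have h1 : Z * Z * x = Z * x := LinearMap.ext fun v => by
    rw [Module.End.mul_apply, Module.End.mul_apply, Module.End.mul_apply, hZP _ (hxim v)]
  have h2 : x * Z * Z = -(x * Z) := LinearMap.ext fun v => by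
    obtain ⟨p, hp, q, hq, rfl⟩ := hdec v
    rw [LinearMap.neg_apply, Module.End.mul_apply, Module.End.mul_apply, Module.End.mul_apply, map_add, map_add,
      hZP p hp, hZQ q hq, map_add, map_add, map_neg, hxP _ (hZP' p hp), zero_add, zero_add]
  have hD : Z * x - x * Z ∈ 𝔊 := hbr Z hZ x hx
  have hD₂ : Z * (Z * x - x * Z) - (Z * x - x * Z) * Z ∈ 𝔊 := hbr Z hZ _ hD
  have e1 : Z * (Z * x - x * Z) = Z * x - Z * x * Z := by rw [mul_sub, ← mul_assoc, h1, ← mul_assoc]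
  have e2 : (Z * x - x * Z) * Z = Z * x * Z + x * Z := by rw [sub_mul, h2, sub_neg_eq_add]
  have key : (2 : ℂ) • (Z * x * Z) = (Z * x - x * Z) - (Z * (Z * x - x * Z) - (Z * x - x * Z) * Z) := by
    rw [e1, e2, two_smul]
    abel
  have hmem : (2 : ℂ) • (Z * x * Z) ∈ 𝔊 := by
    rw [key]
    exact Submodule.sub_mem _ hD hD₂
  exact (Submodule.smul_mem_iff _ two_ne_zero).1 hmem

variable {V : Type u} [AddCommGroup V] [Module ℚ V] [Module.Finite ℚ V] [HodgeTensorFacts.{u, u}] {n : ℤ}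

/-! ## §2 Levi lifts and `ω`-duality -/

set_option maxHeartbeats 800000 in
/-- **Levi modification.**  `H` effective of weight `1`; `Z ∈ 𝔥_ℂ` with `Z P ⊆ P` (`P = V^{1,0}`).  Then there is `Z₀ ∈ 𝔥_ℂ`
preserving `P` and `Q = V^{0,1}` with `Z₀ = Z` on `P` (the degree-`0` component of `Z`).
[cite: Deligne1982HodgeCycles, I §3 (proof of Prop. 3.4)] [cite: MoonenZarhin1999LowDim, §2 (2.3)] -/
theorem LeviCompression.exists_levi_lift (H : HodgeStructure V n) (ψ : H.Polarization) (hn : n = 1) (heff : H.IsEffective)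
    {Z : Module.End ℂ (ℂ ⊗[ℚ] V)} (hZ : Z ∈ H.hodgeLieC) (hZP : ∀ p ∈ H.piece 1 0, Z p ∈ H.piece 1 0) :
    ∃ Z₀ ∈ H.hodgeLieC, (∀ p ∈ H.piece 1 0, Z₀ p = Z p) ∧ (∀ p ∈ H.piece 1 0, Z₀ p ∈ H.piece 1 0) ∧
      (∀ q ∈ H.piece 0 1, Z₀ q ∈ H.piece 0 1) := by
  obtain ⟨hbr, -, -, Θ, hΘ, hΘ𝔤⟩ := hodgeLie_standing H ψ
  have hspan : H.hodgeLieC = spanC H.hodgeLie := hodgeLieC_eq_spanC H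
  have hΘC : Θ ∈ H.hodgeLieC := by rw [hspan]; exact hΘ𝔤
  have hbrC : ∀ Y ∈ H.hodgeLieC, ∀ Y' ∈ H.hodgeLieC, Y * Y' - Y' * Y ∈ H.hodgeLieC := fun Y hY Y' hY' => by
    rw [hspan] at hY hY' ⊢
    exact commutator_mem_spanC hbr hY hY'
  subst hn
  obtain ⟨hPmem, hQmem, hΘ10, hΘ01, hΘΘ⟩ := UnitaryTheta.theta_facts H rfl heff hΘ
  obtain ⟨Zm, -, Z0, hZ0, Zp, -, -, -, -, -, -, hZ0P, -, hZ0P', hZ0Q'⟩ :=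
    SymplecticTheta.exists_decomp H.hodgeLieC hbrC hΘC hΘΘ hΘ10 hΘ01 hPmem hQmem hZ
  refine ⟨Z0, hZ0, fun p hp => ?_, hZ0P', hZ0Q'⟩
  rw [hZ0P p hp, hΘ10 _ (hZP p hp), ← two_smul ℂ (Z p), smul_smul, inv_mul_cancel₀ two_ne_zero, one_smul]

set_option maxHeartbeats 800000 in
/-- **`ω`-duality for Levi elements.**  `H` effective polarized of weight `1`; `Z ∈ 𝔥_ℂ` preserving `P` and `Q` with
`Z² = Z` on `P`.  Then `Z² = −Z` on `Q` (`ψ_ℂ(Z²q + Zq, p) = ψ_ℂ(q, Z²p) − ψ_ℂ(q, Zp) = 0`, `Q` isotropic, `ψ_ℂ`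
non-degenerate). [cite: Deligne1982HodgeCycles, I §3 Prop. 3.4] [cite: MoonenZarhin1999LowDim, §2 (2.3)] -/
theorem LeviCompression.sq_apply_eq_neg_of_sq_apply_eq (H : HodgeStructure V n) (ψ : H.Polarization) (hn : n = 1)
    (heff : H.IsEffective) {Z : Module.End ℂ (ℂ ⊗[ℚ] V)} (hZ : Z ∈ H.hodgeLieC)
    (hZP : ∀ p ∈ H.piece 1 0, Z p ∈ H.piece 1 0) (hZQ : ∀ q ∈ H.piece 0 1, Z q ∈ H.piece 0 1)
    (hZZ : ∀ p ∈ H.piece 1 0, Z (Z p) = Z p) : ∀ q ∈ H.piece 0 1, Z (Z q) = -Z q := by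
  obtain ⟨-, -, -, Θ, hΘ, -⟩ := hodgeLie_standing H ψ
  subst hn
  obtain ⟨hPmem, hQmem, -, -, -⟩ := UnitaryTheta.theta_facts H rfl heff hΘ
  set ω := ψ.form.baseChange ℂ with hω
  have hωnd : ω.Nondegenerate := by rw [hω]; exact ψ.nondegenerate_baseChange
  have hskew : ∀ a b, ω (Z a) b = -ω a (Z b) := fun a b => by rw [hω]; exact formBaseChange_skew_of_mem_hodgeLieC ψ hZ a b
  have hQQ : ∀ q ∈ H.piece 0 1, ∀ q' ∈ H.piece 0 1, ω q q' = 0 := fun q hq q' hq' =>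
    ψ.form_piece_piece (p := 0) (p' := 0) (by norm_num) (by simpa using hq) (by simpa using hq')
  have hvdec : ∀ v : ℂ ⊗[ℚ] V, (2 : ℂ)⁻¹ • (v + Θ v) + (2 : ℂ)⁻¹ • (v - Θ v) = v := fun v => by module
  intro q hq
  rw [← add_eq_zero_iff_eq_neg]
  have hu : Z (Z q) + Z q ∈ H.piece 0 1 := Submodule.add_mem _ (hZQ _ (hZQ q hq)) (hZQ q hq)
  refine hωnd.1 _ fun w => ?_
  rw [← hvdec w, map_add]
  have hp := hPmem w
  have hq' := hQmem w
  rw [hQQ _ hu _ hq', add_zero, map_add, LinearMap.add_apply, hskew, hskew, hskew, neg_neg, hZZ _ hp, add_neg_cancel]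

/-! ## §3 Compressions of lowering operators -/

set_option maxHeartbeats 1600000 in
/-- **Compression of a lowering operator by two Levi idempotents.**  `H` effective polarized of weight `1`; `Z₁, Z₂ ∈ 𝔥_ℂ`
preserving `P`, `Q` and idempotent on `P`; `x ∈ 𝔥_ℂ` lowering (`x Q = 0`, values in `Q`).  Then `Z₂Z₁ x Z₁Z₂ ∈ 𝔥_ℂ`, and
it is lowering. [cite: Deligne1982HodgeCycles, I §3 (proof of Prop. 3.4)] [cite: MoonenZarhin1999LowDim, §2 (2.3)–(2.5)] -/
theorem LeviCompression.compression_mem (H : HodgeStructure V n) (ψ : H.Polarization) (hn : n = 1) (heff : H.IsEffective)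
    {Z₁ Z₂ : Module.End ℂ (ℂ ⊗[ℚ] V)} (hZ₁ : Z₁ ∈ H.hodgeLieC) (hZ₂ : Z₂ ∈ H.hodgeLieC)
    (hZ₁P : ∀ p ∈ H.piece 1 0, Z₁ p ∈ H.piece 1 0) (hZ₁Q : ∀ q ∈ H.piece 0 1, Z₁ q ∈ H.piece 0 1)
    (hZ₂P : ∀ p ∈ H.piece 1 0, Z₂ p ∈ H.piece 1 0) (hZ₂Q : ∀ q ∈ H.piece 0 1, Z₂ q ∈ H.piece 0 1)
    (hZ₁Z₁ : ∀ p ∈ H.piece 1 0, Z₁ (Z₁ p) = Z₁ p) (hZ₂Z₂ : ∀ p ∈ H.piece 1 0, Z₂ (Z₂ p) = Z₂ p)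
    {x : Module.End ℂ (ℂ ⊗[ℚ] V)} (hx : x ∈ H.hodgeLieC) (hxQ : ∀ q ∈ H.piece 0 1, x q = 0)
    (hxim : ∀ v, x v ∈ H.piece 0 1) :
    Z₂ * Z₁ * x * Z₁ * Z₂ ∈ H.hodgeLieC ∧ (∀ q ∈ H.piece 0 1, (Z₂ * Z₁ * x * Z₁ * Z₂) q = 0) ∧
      (∀ v, (Z₂ * Z₁ * x * Z₁ * Z₂) v ∈ H.piece 0 1) := by
  obtain ⟨hbr, -, -, Θ, hΘ, hΘ𝔤⟩ := hodgeLie_standing H ψ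
  have hspan : H.hodgeLieC = spanC H.hodgeLie := hodgeLieC_eq_spanC H
  have hbrC : ∀ Y ∈ H.hodgeLieC, ∀ Y' ∈ H.hodgeLieC, Y * Y' - Y' * Y ∈ H.hodgeLieC := fun Y hY Y' hY' => by
    rw [hspan] at hY hY' ⊢
    exact commutator_mem_spanC hbr hY hY'
  have hsq₁ := LeviCompression.sq_apply_eq_neg_of_sq_apply_eq H ψ hn heff hZ₁ hZ₁P hZ₁Q hZ₁Z₁
  have hsq₂ := LeviCompression.sq_apply_eq_neg_of_sq_apply_eq H ψ hn heff hZ₂ hZ₂P hZ₂Q hZ₂Z₂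
  subst hn
  obtain ⟨hPmem, hQmem, -, -, -⟩ := UnitaryTheta.theta_facts H rfl heff hΘ
  have hdec : ∀ v : ℂ ⊗[ℚ] V, ∃ q ∈ H.piece 0 1, ∃ p ∈ H.piece 1 0, v = q + p := fun v =>
    ⟨_, hQmem v, _, hPmem v, by module⟩
  -- the abstract compression with `(P′, Q′) = (Q, P)` and the element `−Zᵢ`
  have step : ∀ {Z y : Module.End ℂ (ℂ ⊗[ℚ] V)}, Z ∈ H.hodgeLieC → (∀ p ∈ H.piece 1 0, Z p ∈ H.piece 1 0) →
      (∀ q ∈ H.piece 0 1, Z q ∈ H.piece 0 1) → (∀ p ∈ H.piece 1 0, Z (Z p) = Z p) →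
      (∀ q ∈ H.piece 0 1, Z (Z q) = -Z q) → y ∈ H.hodgeLieC → (∀ q ∈ H.piece 0 1, y q = 0) →
      (∀ v, y v ∈ H.piece 0 1) →
      Z * y * Z ∈ H.hodgeLieC ∧ (∀ q ∈ H.piece 0 1, (Z * y * Z) q = 0) ∧ (∀ v, (Z * y * Z) v ∈ H.piece 0 1) := by
    intro Z y hZ hZP hZQ hZZP hZZQ hy hyQ hyim
    have hmem : (-Z) * y * (-Z) ∈ H.hodgeLieC :=
      LeviCompression.mul_mul_mul_mem hbrC hdec (Submodule.neg_mem _ hZ)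
        (fun q hq => by rw [LinearMap.neg_apply, LinearMap.neg_apply, map_neg, neg_neg, hZZQ q hq])
        (fun q hq => by rw [LinearMap.neg_apply]; exact Submodule.neg_mem _ (hZQ q hq))
        (fun p hp => by rw [LinearMap.neg_apply, LinearMap.neg_apply, map_neg, neg_neg, neg_neg, hZZP p hp]) hy hyQ hyim
    have e : (-Z) * y * (-Z) = Z * y * Z := LinearMap.ext fun v => by
      simp only [Module.End.mul_apply, LinearMap.neg_apply, map_neg, neg_neg]
    rw [e] at hmem
    refine ⟨hmem, fun q hq => ?_, fun v => ?_⟩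
    · rw [Module.End.mul_apply, Module.End.mul_apply, hyQ _ (hZQ q hq), map_zero]
    · rw [Module.End.mul_apply, Module.End.mul_apply]
      exact hZQ _ (hyim _)
  obtain ⟨h1, h1Q, h1im⟩ := step hZ₁ hZ₁P hZ₁Q hZ₁Z₁ hsq₁ hx hxQ hxim
  obtain ⟨h2, h2Q, h2im⟩ := step hZ₂ hZ₂P hZ₂Q hZ₂Z₂ hsq₂ h1 h1Q h1im
  have hassoc : Z₂ * Z₁ * x * Z₁ * Z₂ = Z₂ * (Z₁ * x * Z₁) * Z₂ := by simp only [mul_assoc]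
  rw [hassoc]
  exact ⟨h2, h2Q, h2im⟩

set_option maxHeartbeats 1600000 in
/-- **Vanishing of decomposable compressions.**  In the setting of `compression_mem`, suppose that NO non-zero lowering element
of `𝔥_ℂ` has all its values on one line, and that the operator `p ↦ Z₁Z₂ p` on `P` has its values on a line.  Then
`ψ_ℂ(x(Z₁Z₂ p), Z₁Z₂ p′) = 0` for all `p, p′ ∈ P` (the compression `Z₂Z₁xZ₁Z₂` is lowering with values on a line, hence `0`,
and `ψ_ℂ(Z₂Z₁xZ₁Z₂ p, p′) = ψ_ℂ(x Z₁Z₂ p, Z₁Z₂ p′)` by skewness). [cite: Deligne1982HodgeCycles, I §3 Prop. 3.4, Prop. 3.6]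
[cite: MoonenZarhin1999LowDim, §2 (2.3)–(2.5)] -/
theorem LeviCompression.form_compression_eq_zero (H : HodgeStructure V n) (ψ : H.Polarization) (hn : n = 1)
    (heff : H.IsEffective)
    (hnoline : ∀ y ∈ H.hodgeLieC, (∀ q ∈ H.piece 0 1, y q = 0) → (∀ v, y v ∈ H.piece 0 1) →
      ∀ v₀ : ℂ ⊗[ℚ] V, (∀ v, ∃ t : ℂ, y v = t • v₀) → y = 0)
    {Z₁ Z₂ : Module.End ℂ (ℂ ⊗[ℚ] V)} (hZ₁ : Z₁ ∈ H.hodgeLieC) (hZ₂ : Z₂ ∈ H.hodgeLieC)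
    (hZ₁P : ∀ p ∈ H.piece 1 0, Z₁ p ∈ H.piece 1 0) (hZ₁Q : ∀ q ∈ H.piece 0 1, Z₁ q ∈ H.piece 0 1)
    (hZ₂P : ∀ p ∈ H.piece 1 0, Z₂ p ∈ H.piece 1 0) (hZ₂Q : ∀ q ∈ H.piece 0 1, Z₂ q ∈ H.piece 0 1)
    (hZ₁Z₁ : ∀ p ∈ H.piece 1 0, Z₁ (Z₁ p) = Z₁ p) (hZ₂Z₂ : ∀ p ∈ H.piece 1 0, Z₂ (Z₂ p) = Z₂ p)
    {m₁ : ℂ ⊗[ℚ] V} (hline : ∀ p ∈ H.piece 1 0, ∃ t : ℂ, Z₁ (Z₂ p) = t • m₁)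
    {x : Module.End ℂ (ℂ ⊗[ℚ] V)} (hx : x ∈ H.hodgeLieC) (hxQ : ∀ q ∈ H.piece 0 1, x q = 0)
    (hxim : ∀ v, x v ∈ H.piece 0 1) :
    ∀ p ∈ H.piece 1 0, ∀ p' ∈ H.piece 1 0,
      ψ.form.baseChange ℂ (x (Z₁ (Z₂ p))) (Z₁ (Z₂ p')) = 0 := by
  obtain ⟨hy, hyQ, hyim⟩ :=
    LeviCompression.compression_mem H ψ hn heff hZ₁ hZ₂ hZ₁P hZ₁Q hZ₂P hZ₂Q hZ₁Z₁ hZ₂Z₂ hx hxQ hxim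
  obtain ⟨-, -, -, Θ, hΘ, -⟩ := hodgeLie_standing H ψ
  subst hn
  obtain ⟨hPmem, hQmem, -, -, -⟩ := UnitaryTheta.theta_facts H rfl heff hΘ
  have hvdec : ∀ v : ℂ ⊗[ℚ] V, (2 : ℂ)⁻¹ • (v + Θ v) + (2 : ℂ)⁻¹ • (v - Θ v) = v := fun v => by module
  set y := Z₂ * Z₁ * x * Z₁ * Z₂ with hydef
  have hyv : ∀ v, y v = Z₂ (Z₁ (x (Z₁ (Z₂ v)))) := fun v => by
    simp only [hydef, Module.End.mul_apply]
  -- `y` has its values on the line through `Z₂ Z₁ x m₁`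
  have hyline : ∀ v, ∃ t : ℂ, y v = t • Z₂ (Z₁ (x m₁)) := by
    intro v
    obtain ⟨t, ht⟩ := hline _ (hPmem v)
    refine ⟨t, ?_⟩
    have h1 : y v = y ((2 : ℂ)⁻¹ • (v + Θ v)) := by
      conv_lhs => rw [← hvdec v]
      rw [map_add, hyQ _ (hQmem v), add_zero]
    rw [h1, hyv, ht, map_smul, map_smul, map_smul]
  have hy0 : y = 0 := hnoline y hy hyQ hyim _ hyline
  -- skewness
  set ω := ψ.form.baseChange ℂ with hω
  have hskew₁ : ∀ a b, ω (Z₁ a) b = -ω a (Z₁ b) := fun a b => by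
    rw [hω]; exact formBaseChange_skew_of_mem_hodgeLieC ψ hZ₁ a b
  have hskew₂ : ∀ a b, ω (Z₂ a) b = -ω a (Z₂ b) := fun a b => by
    rw [hω]; exact formBaseChange_skew_of_mem_hodgeLieC ψ hZ₂ a b
  intro p _ p' _
  have h := congrArg (fun Y : Module.End ℂ (ℂ ⊗[ℚ] V) => ω (Y p) p') hy0
  simp only [LinearMap.zero_apply, map_zero, LinearMap.zero_apply, hyv, hskew₂, hskew₁, neg_neg] at h
  exact h

/-! ## §4 The commutator criterion -/

set_option maxHeartbeats 1600000 in
/-- **`[Z, x] = 0` from the form.**  `H` effective polarized of weight `1`; `Z ∈ 𝔥_ℂ` preserving `P` and `Q`; `x ∈ 𝔥_ℂ`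
lowering.  If `ψ_ℂ(x(Z p), p′) + ψ_ℂ(x p, Z p′) = 0` for all `p, p′ ∈ P`, then `Z x = x Z`
(`[Z,x] p = Z x p − x Z p ∈ Q` pairs to zero with `P` by skewness and with `Q` by isotropy).
[cite: Deligne1982HodgeCycles, I §3 Prop. 3.4] [cite: MoonenZarhin1999LowDim, §2 (2.3)] -/
theorem LeviCompression.commute_of_form (H : HodgeStructure V n) (ψ : H.Polarization) (hn : n = 1) (heff : H.IsEffective)
    {Z : Module.End ℂ (ℂ ⊗[ℚ] V)} (hZ : Z ∈ H.hodgeLieC) (hZP : ∀ p ∈ H.piece 1 0, Z p ∈ H.piece 1 0)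
    (hZQ : ∀ q ∈ H.piece 0 1, Z q ∈ H.piece 0 1) {x : Module.End ℂ (ℂ ⊗[ℚ] V)}
    (hxQ : ∀ q ∈ H.piece 0 1, x q = 0) (hxim : ∀ v, x v ∈ H.piece 0 1)
    (hform : ∀ p ∈ H.piece 1 0, ∀ p' ∈ H.piece 1 0,
      ψ.form.baseChange ℂ (x (Z p)) p' + ψ.form.baseChange ℂ (x p) (Z p') = 0) :
    Z * x = x * Z := by
  obtain ⟨-, -, -, Θ, hΘ, -⟩ := hodgeLie_standing H ψ
  subst hn
  obtain ⟨hPmem, hQmem, -, -, -⟩ := UnitaryTheta.theta_facts H rfl heff hΘ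
  set ω := ψ.form.baseChange ℂ with hω
  have hωnd : ω.Nondegenerate := by rw [hω]; exact ψ.nondegenerate_baseChange
  have hskew : ∀ a b, ω (Z a) b = -ω a (Z b) := fun a b => by rw [hω]; exact formBaseChange_skew_of_mem_hodgeLieC ψ hZ a b
  have hQQ : ∀ q ∈ H.piece 0 1, ∀ q' ∈ H.piece 0 1, ω q q' = 0 := fun q hq q' hq' =>
    ψ.form_piece_piece (p := 0) (p' := 0) (by norm_num) (by simpa using hq) (by simpa using hq')
  have hvdec : ∀ v : ℂ ⊗[ℚ] V, (2 : ℂ)⁻¹ • (v + Θ v) + (2 : ℂ)⁻¹ • (v - Θ v) = v := fun v => by module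
  -- it suffices to check on `P`
  have hP : ∀ p ∈ H.piece 1 0, Z (x p) - x (Z p) = 0 := by
    intro p hp
    have hu : Z (x p) - x (Z p) ∈ H.piece 0 1 := Submodule.sub_mem _ (hZQ _ (hxim p)) (hxim _)
    refine hωnd.1 _ fun w => ?_
    rw [← hvdec w, map_add, hQQ _ hu _ (hQmem w), add_zero, map_sub, LinearMap.sub_apply, hskew]
    have h := hform p hp _ (hPmem w)
    rw [← neg_eq_zero, neg_sub, sub_eq_add_neg, neg_neg]
    exact h
  refine LinearMap.ext fun v => ?_
  rw [Module.End.mul_apply, Module.End.mul_apply, ← hvdec v, map_add, map_add, map_add, map_add,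
    hxQ _ (hQmem v), map_zero, add_zero, hxQ _ (hZQ _ (hQmem v)), add_zero]
  exact sub_eq_zero.1 (hP _ (hPmem v))

end HodgeStructure

end Literature.AlgebraicGeometry.Motives
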